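import Literature.NumberTheory.ConnesConsani2021.ProlateEigenvalueExplicitDecayNumerics
import Literature.NumberTheory.ConnesConsani2021.ProlateEigenvalueMomentDecay
import Literature.NumberTheory.ConnesConsani2021.SeriesRemainderParametricTail
import HarnessLib

/-!
# The (E-a) high-mode tail: `|Σ_{n ≥ 8} τ(n)T_n(ρ)| ≤ 7/5000` on `[1,2]`, unconditionally

RH-FREE corpus literature (label, line 1): the App. F remainder of Connes–Consani 2021 (Lemma F.1 (i),
(computersafe)) for THE prolate sequence beyond the eight FI-enclosed modes, bounded by a PROVED hybrid
majorant of `|λ(n)|`: the explicit index-wise `R(n)` for `8 ≤ n < 24`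
(`ProlateEigenvalueExplicitDecay[Numerics].lean`, this seat) and seat t6's moment bound `4(4π²)ⁿ/(n!)²`
for `n ≥ 24` (`ProlateEigenvalueMomentDecay.lean`).  Nothing here mentions `ζ` or RH; nothing here bears
on the truth of RH.  bears_on (cell rh-crit): the tail hypothesis `hT` (with `N₁ = 8`, `T = 7/5000`) of
the panel certificate `section6_enclosures_of_panels` / `…_of_uniformVpanels_of_majorant` (seat t7) for
the (E-a) conjunct of `CC2021_section6_enclosures` (route «ConnesConsaniSemilocal», item K3
`WindowSpectralBound`, stmt 19306).

## What is proved (theorems only)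

* `sonineQTerm_prolateFun_tail_eight` — for `ρ ∈ [1,2]`: `Σ_{k} τ(k+8)T_{k+8}(ρ)` converges absolutely
  and `|Σ_k τ(k+8)T_{k+8}(ρ)| ≤ 7/5000` (`lemma_49_i_prolateFun_of_majorant` with `N = 7` and the hybrid
  majorant; block sum `≤ 1/1000`, far tail `≤ 1/2500`);
* `abs_tsum_sonineQTerm_sub_sum_eight_le` — the same in the frame's shape
  `|Σ' n, τ(n)T_n(ρ) − Σ_{n<8} τ(n)T_n(ρ)| ≤ 7/5000`;
* `hybrid24_abs_prolateEigen_le`, `hybrid24_le`, `hybrid24_summable_mul_remainderPoly`, `hybrid24_tsum_le` —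
  the four majorant-form hypotheses `hR`, `hR'`, `hRs`, `hRT` (`N₁ = 8`, `T = 7/5000`) of the frames
  `section6_enclosures_of_panels_of_majorant` / `…_of_uniformVpanels_of_majorant`.

[cite: ConnesConsani2021, App. F Lemma F.1 (i) (arXiv Lemma 49) eq. (computersafe), arXiv PDF p. 55;
Prop. 5.3 eq. (sonineQ) (arXiv item 30)].  WHAT THIS FILE IS NOT: a statement about `ζ` or RH; the
panel certificate itself.  Nothing here bears on the truth of RH.
-/

noncomputable section

open Real Set Finset

namespace Literature.NumberTheory.ConnesConsani2021

open Literature.NumberTheory.LFunctions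


/-- RH-FREE. **The App. F tail beyond the eight FI-enclosed modes**: for every `ρ ∈ [1,2]`, the series
`Σ_{n ≥ 8} τ(n)T_n(ρ)` (terms `sonineQTerm (prolateFun n) (prolateEigen n) ρ`) converges absolutely and
`|Σ_{n≥8} τ(n)T_n(ρ)| ≤ 1/1000 + 1/2500 = 7/5000` — hybrid majorant `R(n)` (`8 ≤ n < 24`, this file) /
`4(4π²)ⁿ/(n!)²` (`n ≥ 24`, seat t6).  No hypothesis.
[cite: ConnesConsani2021, App. F Lemma F.1 (i) (arXiv Lemma 49) eq. (computersafe), arXiv PDF p. 55 (chunk p0035:L78–L81); RokhlinXiao2007, §4] -/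
theorem sonineQTerm_prolateFun_tail_eight {ρ : ℝ} (hρ : ρ ∈ Icc (1 : ℝ) 2) :
    Summable (fun k : ℕ ↦ sonineQTerm (prolateFun (k + 8)) (prolateEigen (k + 8)) ρ) ∧
      |∑' k : ℕ, sonineQTerm (prolateFun (k + 8)) (prolateEigen (k + 8)) ρ| ≤ 7 / 5000 := by
  set r : ℕ → ℝ := fun n ↦
    if n < 24 then prolateEigenMajorant n else 4 * (4 * π ^ 2) ^ n / (n.factorial : ℝ) ^ 2
  have hR : ∀ n, 7 < n → |prolateEigen n| ≤ r n := fun n hn ↦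
    abs_prolateEigen_le_hybrid (R := prolateEigenMajorant)
      (fun _ h8 _ ↦ abs_prolateEigen_le_prolateEigenMajorant h8) n (by omega)
  have hR' : ∀ n, 7 < n → r n ≤ 13 / 200 := fun n hn ↦
    hybrid_le (R := prolateEigenMajorant) (fun _ h8 h24 ↦ prolateEigenMajorant_le_of_mem_Ico h8 h24) n
      (by omega)
  have hRs : Summable (fun n ↦ r n * remainderPoly n) := summable_hybrid_mul_remainderPoly prolateEigenMajorant
  have h := lemma_49_i_prolateFun_of_majorant (N := 7) (by norm_num) hR hR' hRs hρ
  have ht := tsum_hybrid_le (R := prolateEigenMajorant) sum_Ico_prolateEigenMajorant_mul_le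
  refine ⟨h.1, h.2.trans (le_trans (le_of_eq ?_) (ht.trans (by norm_num)))⟩
  rfl

/-- RH-FREE. **The tail in the shape of the panel frame's `hT`** (`section6_enclosures_of_panels`, seat t7,
`N₁ = 8`): `|Σ' n, τ(n)T_n(ρ) − Σ_{n<8} τ(n)T_n(ρ)| ≤ 7/5000` for every `ρ ∈ [1,2]`.
[cite: ConnesConsani2021, App. F Lemma F.1 (i) (arXiv Lemma 49) eq. (computersafe); Prop. 5.3 eq. (sonineQ) (arXiv item 30)] -/
theorem abs_tsum_sonineQTerm_sub_sum_eight_le {ρ : ℝ} (hρ : ρ ∈ Icc (1 : ℝ) 2) :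
    |∑' n : ℕ, sonineQTerm (prolateFun n) (prolateEigen n) ρ -
        ∑ n ∈ Finset.range 8, sonineQTerm (prolateFun n) (prolateEigen n) ρ| ≤ 7 / 5000 := by
  have hs := summable_sonineQTerm_prolateFun hρ
  rw [← hs.sum_add_tsum_nat_add 8, add_sub_cancel_left]
  exact (sonineQTerm_prolateFun_tail_eight hρ).2

/-! ## The four majorant-form hypotheses of the panel frames (`N₁ = 8`, 24-cut hybrid, `T = 7/5000`)

For `section6_enclosures_of_panels_of_majorant` / `section6_enclosures_of_uniformVpanels_of_majorant`
(seat t7) with `R := fun n ↦ if n < 24 then prolateEigenMajorant n else 4(4π²)ⁿ/(n!)²`. -/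

/-- `hR`: `|λ(n)| ≤ hybrid(n)` for `n ≥ 8`. [cite: ConnesConsani2021, App. F Lemma F.1 (i) (arXiv Lemma 49); RokhlinXiao2007, §4] -/
theorem hybrid24_abs_prolateEigen_le (n : ℕ) (hn : 8 ≤ n) :
    |prolateEigen n| ≤
      (if n < 24 then prolateEigenMajorant n else 4 * (4 * π ^ 2) ^ n / (n.factorial : ℝ) ^ 2) :=
  abs_prolateEigen_le_hybrid (R := prolateEigenMajorant)
    (fun _ h8 _ ↦ abs_prolateEigen_le_prolateEigenMajorant h8) n hn

/-- `hR'`: `hybrid(n) ≤ 13/200` for `n ≥ 8`. [cite: ConnesConsani2021, App. F Lemma F.1 (i) (arXiv Lemma 49)] -/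
theorem hybrid24_le (n : ℕ) (hn : 8 ≤ n) :
    (if n < 24 then prolateEigenMajorant n else 4 * (4 * π ^ 2) ^ n / (n.factorial : ℝ) ^ 2) ≤ 13 / 200 :=
  hybrid_le (R := prolateEigenMajorant) (fun _ h8 h24 ↦ prolateEigenMajorant_le_of_mem_Ico h8 h24) n hn

/-- `hRs`: `Σ hybrid(n)·p(n) < ∞`. [cite: ConnesConsani2021, App. F Lemma F.1 (arXiv Lemma 49)] -/
theorem hybrid24_summable_mul_remainderPoly :
    Summable (fun n : ℕ ↦
      (if n < 24 then prolateEigenMajorant n else 4 * (4 * π ^ 2) ^ n / (n.factorial : ℝ) ^ 2) *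
        remainderPoly n) :=
  summable_hybrid_mul_remainderPoly prolateEigenMajorant

/-- `hRT`: `Σ_k hybrid(k+8)·4πp(k+8) ≤ 7/5000`. [cite: ConnesConsani2021, App. F Lemma F.1 (i) (arXiv Lemma 49) eq. (computersafe)] -/
theorem hybrid24_tsum_le :
    ∑' k : ℕ, (if k + 8 < 24 then prolateEigenMajorant (k + 8)
        else 4 * (4 * π ^ 2) ^ (k + 8) / ((k + 8).factorial : ℝ) ^ 2) * (4 * π * remainderPoly (k + 8))
      ≤ 7 / 5000 :=
  (tsum_hybrid_le (R := prolateEigenMajorant) sum_Ico_prolateEigenMajorant_mul_le).trans (by norm_num)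

end Literature.NumberTheory.ConnesConsani2021

end
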